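import Mathlib.RingTheory.AlgebraicIndependent.TranscendenceBasis
import Mathlib.LinearAlgebra.Basis.VectorSpace
import Mathlib.Algebra.Polynomial.Div
import Mathlib.RingTheory.Localization.FractionRing
import Mathlib.Data.Matrix.Mul

/-!
# Route ConvexRankGates, crux `LinAlgGateBlind` (stmt-PneNP-10681): facet count for linear pencils, III — transcendence degree and descent

Support lemmas for the crux (vocabulary of `Theorems/ConvexRankGatesLinAlgGateBlindDefs.lean`); third file of the
facet count for linear pencils (see `…FacetKernel`, `…FacetSubst`). Two pieces of commutative algebra used by the
TRANSPORT step (a sub-pencil whose kernel-vector algebra has the same transcendence degree as that of a larger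
sub-pencil inherits its criterion):

* `algHom_injective_of_surjective_of_trdeg_eq` — a SURJECTIVE `F`-algebra homomorphism `φ : A' → A` between
  domains of EQUAL FINITE transcendence degree over a field `F` is injective. (Lift a transcendence basis `T` of `A`
  to `T' ⊆ A'`; `T'` is algebraically independent with `#T' = trdeg A'`, hence a transcendence basis, so a non-zero
  `x ∈ ker φ` satisfies `q(x) = 0` for some `q ∈ F[T'][t]` with `q(0) ≠ 0`; applying `φ` gives `φ(q(0)) = 0`, but `φ`
  is injective on `F[T']` because `φ ∘ T' = T` is algebraically independent.)
* `exists_mulVec_eq_of_ringHom` — **descent of linear solvability** along a field extension `i : K → L`: a linear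
  system with coefficients in `K` that is solvable over `L` is solvable over `K` (apply a `K`-linear retraction
  `L → K` of `i` to a solution); `exists_mulVec_eq_transfer` — hence for a domain `A` with embeddings `f : A ↪ L`,
  `g : A ↪ L'` into fields, a system over `A` solvable over `L` is solvable over `L'` (through `Frac A`).

Sources: [folklore] (transcendence bases: Mathlib `Algebra.trdeg`; linear algebra). No new definitions. [folklore]
-/

-- `Summit.PneNP.PneNP.…` duplicates `PneNP` BY DESIGN (single-problem summit).
set_option linter.dupNamespace false

namespace Summit.PneNP.PneNP.Theorems

open Matrix

universe u

/-! ### Equal transcendence degree and surjectivity force injectivity -/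

/-- **A surjection between domains of equal finite transcendence degree is injective.** Let `F` be a field,
`A, A'` commutative domains and `F`-algebras, `φ : A' →ₐ[F] A` surjective, `trdeg_F A < ℵ₀` and
`trdeg_F A' = trdeg_F A`. Then `φ` is injective. Proof: lift a (finite) transcendence basis `T` of `A` along `φ` to
`T'`; `T'` is algebraically independent (a relation would map to a relation of `T`) of cardinality `trdeg A'`, hence
a transcendence basis of `A'`, so `A'` is algebraic over `F[T']`. If `x ≠ 0`, `φ x = 0`, pick `q ∈ F[T'][t]` with
`q(x) = 0` and `q(0) ≠ 0` (divide out the exact power of `t`, `A'` being a domain); applying `φ` gives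
`φ(q(0)) = q^φ(φ x) = q^φ(0) = 0`, contradicting injectivity of `φ` on `F[T']` (`φ ∘ T' = T` is algebraically
independent). [folklore] -/
theorem algHom_injective_of_surjective_of_trdeg_eq : ∀ {F : Type*} [Field F] {A A' : Type u}
    [CommRing A] [CommRing A'] [IsDomain A] [IsDomain A'] [Algebra F A] [Algebra F A'] (φ : A' →ₐ[F] A),
    Function.Surjective φ → Algebra.trdeg F A < Cardinal.aleph0 → Algebra.trdeg F A' = Algebra.trdeg F A →
    Function.Injective φ := by
  intro F _ A A' _ _ _ _ _ _ φ hφ hfin heq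
  classical
  haveI : FaithfulSMul F A := (faithfulSMul_iff_algebraMap_injective F A).2 (algebraMap F A).injective
  -- a finite transcendence basis of `A`
  obtain ⟨s, hs⟩ := exists_isTranscendenceBasis F A
  haveI : Finite s := Cardinal.mk_lt_aleph0_iff.1 (by rw [hs.cardinalMk_eq_trdeg]; exact hfin)
  -- lifted along `φ`
  set T' : s → A' := fun a => Function.surjInv hφ (a : A) with hT'
  have hφT' : ∀ a : s, φ (T' a) = a := fun a => Function.surjInv_eq hφ (a : A)
  have hcomp : (fun a : s => φ (T' a)) = (Subtype.val : s → A) := funext hφT'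
  have hT'ind : AlgebraicIndependent F T' :=
    AlgebraicIndependent.of_comp φ (by rw [show (⇑φ ∘ T') = (Subtype.val : s → A) from hcomp]; exact hs.1)
  have hT'basis : IsTranscendenceBasis F T' :=
    hT'ind.isTranscendenceBasis_of_trdeg_le_of_finite (by rw [heq, ← hs.cardinalMk_eq_trdeg])
  haveI halg : Algebra.IsAlgebraic (Algebra.adjoin F (Set.range T')) A' := hT'basis.isAlgebraic
  -- `φ` is injective on `F[T']`
  have hφS : ∀ a ∈ Algebra.adjoin F (Set.range T'), φ a = 0 → a = 0 := by
    intro a ha h0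
    rw [Algebra.adjoin_range_eq_range_aeval] at ha
    obtain ⟨p, rfl⟩ := ha
    have h1 : MvPolynomial.aeval (Subtype.val : s → A) p = 0 := by
      rw [← hcomp, ← MvPolynomial.comp_aeval, AlgHom.comp_apply]
      exact h0
    have hp : p = 0 := by
      have h2 := hs.1
      rw [algebraicIndependent_iff_injective_aeval] at h2
      exact h2 (by rw [h1, map_zero])
    rw [hp, map_zero]
  -- main argument
  rw [injective_iff_map_eq_zero]
  intro x hx
  by_contra hx0
  obtain ⟨p, hp0, hpx⟩ := halg.isAlgebraic x
  obtain ⟨q, hpq, hq⟩ := Polynomial.exists_eq_pow_rootMultiplicity_mul_and_not_dvd p hp0 0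
  have hq0 : q.coeff 0 ≠ 0 := by
    rwa [map_zero, sub_zero, Polynomial.X_dvd_iff] at hq
  have hqx : Polynomial.aeval x q = 0 := by
    rw [hpq, map_mul, map_pow, map_sub, Polynomial.aeval_X, Polynomial.aeval_C, map_zero, sub_zero] at hpx
    rcases mul_eq_zero.1 hpx with h | h
    · exact absurd (pow_eq_zero_iff'.1 h).1 hx0
    · exact h
  have key : φ (algebraMap (Algebra.adjoin F (Set.range T')) A' (q.coeff 0)) = 0 := by
    have h1 := Polynomial.hom_eval₂ q (algebraMap (Algebra.adjoin F (Set.range T')) A') (φ : A' →+* A) x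
    simp only [RingHom.coe_coe] at h1
    rw [← Polynomial.aeval_def, hqx, map_zero, hx, Polynomial.eval₂_at_zero, RingHom.comp_apply,
      RingHom.coe_coe] at h1
    exact h1.symm
  have hval : φ ((q.coeff 0 : Algebra.adjoin F (Set.range T')) : A') = 0 := key
  have h3 := hφS _ (q.coeff 0).2 hval
  exact hq0 (Subtype.ext h3)

/-! ### Descent and transfer of linear solvability -/

/-- **Descent of linear solvability along a field extension.** If a linear system `A x = b` with coefficients in a
field `K` has a solution over an extension field `L` (along `i : K →+* L`), it has a solution in `K`: apply a
`K`-linear retraction `L → K` of `i` to the solution. [folklore] -/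
theorem exists_mulVec_eq_of_ringHom {K L : Type*} [Field K] [Field L] (i : K →+* L) {m n : Type*} [Fintype m]
    [Fintype n] (A : Matrix m n K) (b : m → K) (h : ∃ x : n → L, A.map i *ᵥ x = fun a => i (b a)) :
    ∃ x : n → K, A *ᵥ x = b := by
  letI : Algebra K L := i.toAlgebra
  obtain ⟨x, hx⟩ := h
  obtain ⟨g, hg⟩ := (Algebra.linearMap K L).exists_leftInverse_of_injective
    (LinearMap.ker_eq_bot.2 (algebraMap K L).injective)
  have hga : ∀ c : K, g (i c) = c := fun c => by
    have h := LinearMap.congr_fun hg c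
    rw [LinearMap.comp_apply, Algebra.linearMap_apply, LinearMap.id_apply] at h
    exact h
  refine ⟨fun j => g (x j), funext fun a => ?_⟩
  have hrow := congr_fun hx a
  simp only [mulVec, dotProduct, Matrix.map_apply] at hrow ⊢
  calc ∑ j, A a j * g (x j) = g (∑ j, i (A a j) * x j) := by
        rw [map_sum]
        refine Finset.sum_congr rfl fun j _ => ?_
        rw [← smul_eq_mul, ← map_smul, Algebra.smul_def]
        rfl
    _ = b a := by rw [hrow, hga]

/-- **Transfer of linear solvability between two embeddings of a domain.** Let `A` be a domain with injective ring
homomorphisms `f : A → L`, `g : A → L'` into fields. If the system `Coef · x = rhs` (data in `A`) is solvable over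
`L` along `f`, it is solvable over `L'` along `g`: both maps factor through `Frac A`, descend from `L` to `Frac A`
(`exists_mulVec_eq_of_ringHom`) and push forward to `L'`. [folklore] -/
theorem exists_mulVec_eq_transfer {A : Type*} [CommRing A] [IsDomain A] {L L' : Type*} [Field L] [Field L']
    (f : A →+* L) (g : A →+* L') (hf : Function.Injective f) (hg : Function.Injective g)
    {m n : Type*} [Fintype m] [Fintype n] (Coef : Matrix m n A) (rhs : m → A)
    (h : ∃ x : n → L, Coef.map f *ᵥ x = fun a => f (rhs a)) :
    ∃ x : n → L', Coef.map g *ᵥ x = fun a => g (rhs a) := by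
  set Q := FractionRing A with hQ
  set f' : Q →+* L := IsFractionRing.lift hf with hf'def
  set g' : Q →+* L' := IsFractionRing.lift hg with hg'def
  have hf' : ∀ a, f' (algebraMap A Q a) = f a := fun a => IsFractionRing.lift_algebraMap hf a
  have hg' : ∀ a, g' (algebraMap A Q a) = g a := fun a => IsFractionRing.lift_algebraMap hg a
  have hCf : Coef.map f = (Coef.map (algebraMap A Q)).map f' := by
    rw [Matrix.map_map]
    congr 1
    funext a
    exact (hf' a).symm
  have hCg : Coef.map g = (Coef.map (algebraMap A Q)).map g' := by
    rw [Matrix.map_map]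
    congr 1
    funext a
    exact (hg' a).symm
  obtain ⟨x, hx⟩ := h
  obtain ⟨xq, hxq⟩ := exists_mulVec_eq_of_ringHom f' (Coef.map (algebraMap A Q))
    (fun a => algebraMap A Q (rhs a)) ⟨x, by
      rw [← hCf, hx]
      funext a
      exact (hf' (rhs a)).symm⟩
  refine ⟨fun j => g' (xq j), funext fun a => ?_⟩
  rw [hCg]
  have h1 := RingHom.map_mulVec g' (Coef.map (algebraMap A Q)) xq a
  rw [hxq] at h1
  rw [show (g' ∘ xq) = fun j => g' (xq j) from rfl] at h1
  rw [← h1, hg']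

end Summit.PneNP.PneNP.Theorems
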